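import Summits.AtomisticToContinuum.Crystallization.Theorems.ChartedZeroExcessLayeredLatticeLiouvilleUG
import Literature.MathematicalPhysics.StatisticalMechanics.LennardJonesClusters

/-!
# Zero-excess layered lattice Liouville — part UH (lens-2 g50, node «ClampedCore» beneath [I_D] `DressedCorePG`):
# the special door in LOCAL CLAMPED form — `[I_D] ⟸ [CG] ClampedCorePG … M ρ …` (PROVED, every `ρ`, every `M`), the energy hypothesis
# localised from e⋆-grand-canonical stability of the whole configuration to GRAND CLAMPED MINIMALITY OF ONE FINITE REGION (the `ρ`-core of
# the container; `IsGrandClampedMin` = the clause of `IsEStarGSC` verbatim at one region), and its `M = 1` GAP FORM [CG₁] `CoreGapPG … ρ …`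
# (critic row 826 (a): «a ϑ-hot registered core admits a finite replacement strictly lowering the grand energy»), `[CG₁] ⇒ [I_D](M = 1)` PROVED

Line `_16XH19(_tol)` of statement 26636, (M)-side, after parts UC–UG: (M) ⟸ Gehring-leaf ∧ [I_D] ∧ [T_b] ∧ [KS] ∧ [W] ∧ [CC°_W] (docket of record,
critic rows 792/805/826, every seam proved).  NO NEW CUT (rows 792 (5) / 826 (c): the residual [T_b] `BareTameWindowPG` is untouched; [CG₁] is an
OFFERED SUFFICIENT CONDITION under [I_D](M = 1)); this file executes row 805 (iii) / row 826 (iv)(a)(b) now that the census has reported ((F0b)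
(F0e′)(F0g)(F0c)(F0d′) MEASURED, census-1 g24, evidence `F0ZOO24.md` 9eaf4435).
THE COMPETITOR (g48 §1.2, rows 805 (i) / 826 (A)(i)).  `IsEStarGSC (μS S)` quantifies over EVERY finite family `xf ⊆ S` and EVERY finite
replacement `R` of ANY cardinality `k` avoiding `S ∖ xf`: `E_int(xf) + E(xf | S ∖ xf) − e⋆·#xf ≤ E_int(R) + E(R | S ∖ xf) − e⋆·k` — grand-canonical
clamped minimality of every finite region, exterior frozen, zero gluing cost, `R` neither clean nor charted nor Nash.  CURRENCY: `clampedEnergy X xf`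
(energy of the family `xf` in the frozen field of `X`); `IsGrandClampedMin S C` = that clause AT THE ONE REGION `C` (so the count-changing
competitors that kill point-defect cores by their formation excess `ΔΩ⋆ ∈ [0.64, 9.95]`, census (F0b), and the equal-count slaved fill that kills
elastic hot cores by `≥ 0.011` live in ONE inequality, row 826 (a)); `IsClampedMin S C` = its equal-count case.  PROVED: GSC ⇒ grand-clamped-minimal
on every region ⇒ clamped-minimal; single-site Nash ⟺ clamped minimality of every ONE-ATOM region (`isNash_iff_isClampedMin_singleton`) — the
new hypothesis sits on N's own axis: `#C` atoms and free count instead of one atom.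
THE DOOR [CG] `ClampedCorePG ϑ ϑe ωe p r₀ ℓ M ρ aHi Λ θ s`: verbatim [I_D] with `IsDoorSetPG` (clean ∧ Nash ∧ charted ∧ e⋆-GSC) WEAKENED to
`IsDoorSetP` (clean ∧ Nash ∧ charted) plus pair-sum summability plus `IsGrandClampedMin S (coreOf S K ρ)` at the ONE finite region
`coreOf S K ρ = S ∩ ⋃_{k ∈ K} closedBall k ρ` (`coreOf_finite`).  `[CG](ρ) ⇒ [I_D]` for EVERY `ρ` and `M` (`dressedCorePG_of_clampedCorePG`);
`[CG](M = 1, ρ) ⟺ [CG₁](ρ)` (`clampedCorePG_one_of_coreGapPG`, `coreGapPG_of_clampedCorePG_one`) and the seam asked in row 826 (b)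
`dressedCorePG_one_of_coreGapPG : [CG₁](ρ) ⇒ [I_D](M = 1)` with NO side condition on `r₀, ρ, ℓ` (GSC clamps every finite region).  Record
`ρ = clampRadius = 12` (g49 §1; row 826 (A)(i): `ρ` a parameter, `ρ = 8` the cheap-certificate fallback).  (K3) of row 826: the tree's `lennardJones`
is untruncated and so are [CG]/[CG₁] — the exterior field is the FULL frozen `S ∖ core` (`∑'`, summability a binder), so the far-exterior `r⁻⁶`
tail (`d ≥ ℓ`, un-enveloped, only `δ`-separated) sits inside the inequality as a proof obligation of the leaf (numerically `ΔI ≲ 10⁻⁶`).  Docket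
through [CG]: `strainNonConcentrationPG_of_clampedCore_line` (PROVED, axioms standard); dials `ClampedCorePG.mono` (as [I_D]) and the CLAMP-RADIUS
DIAL `ClampedCorePG.of_le` (PROVED: `[CG](ρ) ⇒ [CG](ρ')` for `ρ ≤ ρ'` — grand clamped minimality passes to finite sub-regions,
`IsGrandClampedMin.anti`, a `Fin.append` ledger); ends guarded (`clampedCorePG_zero`).
STATUS (honest; tags per row 826).  [I_D](M = 1): PRICED·HARMONIC·CALIBRATED — calibration of record = g49's CONSERVATIVE variant §3.3 + all §4
allowances at `ρ = 12`: `C_ell(12) ≤ 2.3–2.5`, `m_s ≤ 0.0058–0.0063 ≪ ϑ = 1/20`, harmonic gap `≥ 0.0110` fcc / `0.0111` hcp (tree units), `× 0.84`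
anharmonic worst case `⇒ ≥ 0.0092 ≈ 0.11 ε`, margin to the tameness threshold `× 8`; stacking-blind at calibration grade (hcp column, row 826 (d));
calibration currency, not a Lean constant.  [CG₁]/[CG]: MECHANISM-NAMED ((K1) registration · (K2) no elastic bistability of the clamped core ·
(K3) slaving + tail) · LOCAL · FINITE · PRICED · ATTACKABLE·L (computer-assisted: Newton–Kantorovich on the displacement class + exclusion of
non-displacement clean fillings) · INSTRUMENTABLE (census tag «F0d″-S», MED: the (F0d′) multistart under ADMISSIBLE EXTERIOR STRAIN at `ρ ∈ {12, 8}`;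
KILL SIGN = a CLEAN end state set-distinct from the returned filling with centre `m⋆ ≥ 1/20` and clamped energy `≤ E(returned) + 0.011`) ·
CENSUS-CONSISTENT ((F0d′) `143/168` return exactly, `25` unclean Frenkel pairs, NO clean hot filling; (F0g) every hot compact core unclean and dressed
with `≤ 14`; the only clean ∧ charted ∧ Nash hot structures are flat SHEETS, `M_dr = ∞` — bare side, SHEET24) · UNDECIDED.  FORESHADOWED (row 826 (c),
g51+, NOT here): [CG₁] ⟸ [CF] «a θ-clean filling of a registered ball is displacement-class» ∧ [HG] «certified harmonic gap on that class».
WHY THIS IS NOVEL (by construction).  Parts UC–UG cut the hot-star question by amplitude, collar geometry, connectivity and radial profile, always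
against the GLOBAL grand-canonical door; part UH changes the ENERGY currency of the special side to the clamped minimality of ONE finite region in
a frozen frame — the boundary-value-problem reading of lattice-defect cores (Braun–Schmidt, Ehrlacher–Ortner–Shapeev, Braun–Hudson–Ortner)
used as the HYPOTHESIS of a door, N's Nash binder exhibited as its one-atom case; the other lenses' nodes read 11071, 14231, 31280, 27623, 27506.
-/

noncomputable section

open MeasureTheory Set Metric Filter Topology
open Summit.AtomisticToContinuum.Crystallization.Theorems.ChartedPlanarOrderRigidityDoor (E3 eStar atomsIn IsEStarGSC IsNash)
open Summit.AtomisticToContinuum.Crystallization.Theorems.ChartedPlanarOrderDensityDichotomy (μS nK IsSep)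
open Summit.AtomisticToContinuum.Crystallization.Theorems.ChartedPlanarOrderCleanScaleP (IsDoorSetP)
open Summit.AtomisticToContinuum.Crystallization.Theorems.ChartedPlanarOrderMesoCut (LayeredHom)
open Summit.AtomisticToContinuum.Crystallization.Theorems.ChartedPlanarOrderDoorLayered (atomsIn_subset)
open Summit.AtomisticToContinuum.Crystallization.Theorems.ChartedPlanarOrderDoorLayeredOsc (IsTwoShellAffineGood mem_iff_μS_singleton_ne_zero)
open Literature.MathematicalPhysics.StatisticalMechanics (lennardJones interactionEnergy interactionEnergy_of_subsingleton interactionEnergy_append)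
open Literature.Analysis.PDE (ZatorskaGoldstein2005_localGehringLemmaCounting)

namespace Summit.AtomisticToContinuum.Crystallization.Theorems.ChartedZeroExcessLayeredLatticeLiouville

/-! ### YH.1  Clamped energy; grand / canonical clamped minimality of ONE finite region (the currency); GSC ⇒ both; Nash = the one-atom case -/

/-- ★ **`clampedEnergy X xf`** — the energy of the finite family `xf : Fin n → E3` IN THE FROZEN FIELD of the set `X`: its Lennard-Jones interaction
energy plus the (untruncated) pair sums against `X` — the two configuration terms of `IsEStarGSC`. [this file, g50] -/
def clampedEnergy (X : Set E3) {n : ℕ} (xf : Fin n → E3) : ℝ :=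
  interactionEnergy lennardJones xf + ∑ i, ∑' y : X, lennardJones (dist (xf i) (y : E3))

/-- ★ **`IsGrandClampedMin S C`** — the region `C` of `S` is a GRAND-CANONICAL CLAMPED MINIMISER at chemical potential `e⋆`: for every injective
enumeration `xf` of `C` and every injective replacement `R` of ANY cardinality `k` avoiding the frozen exterior `S ∖ C`,
`clampedEnergy (S ∖ C) xf − e⋆·n ≤ clampedEnergy (S ∖ C) R − e⋆·k` — the clause of `IsEStarGSC` VERBATIM, at the one region `C` (row 826 (a)).
No cleanliness, chart or Nash condition on `R`; zero gluing cost.  Vacuous unless `C` is finite. [this file, g50] -/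
def IsGrandClampedMin (S C : Set E3) : Prop :=
  ∀ (n : ℕ) (xf : Fin n → E3), Function.Injective xf → Set.range xf = C →
    ∀ (k : ℕ) (R : Fin k → E3), Function.Injective R → Disjoint (Set.range R) (S \ C) →
      clampedEnergy (S \ C) xf - eStar * n ≤ clampedEnergy (S \ C) R - eStar * k

/-- ★ **`IsClampedMin S C`** — the EQUAL-COUNT (canonical, Dirichlet) case: no injective same-cardinality re-placement of the atoms of `C` avoiding
`S ∖ C` lowers the clamped energy against `S ∖ C`. [this file, g50] -/
def IsClampedMin (S C : Set E3) : Prop :=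
  ∀ (n : ℕ) (xf : Fin n → E3), Function.Injective xf → Set.range xf = C →
    ∀ R : Fin n → E3, Function.Injective R → Disjoint (Set.range R) (S \ C) → clampedEnergy (S \ C) xf ≤ clampedEnergy (S \ C) R

/-- grand clamped minimality gives canonical clamped minimality (`k := n`, the `e⋆`-terms cancel). [this file, g50] -/
theorem IsGrandClampedMin.isClampedMin {S C : Set E3} (h : IsGrandClampedMin S C) : IsClampedMin S C :=
  fun n xf hxf hrange R hR hdisj => by have key := h n xf hxf hrange n R hR hdisj; linarith

/-- ★★ **GSC ⇒ GRAND-CLAMPED-MINIMAL ON EVERY REGION (PROVED)** — `IsEStarGSC (μS S)` specialised to the one region `C ⊆ S` (set dictionary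
`{p | μS S {p} ≠ 0} = S`; g48 §1.2, rows 805 (i) / 826 (A)(i)). [this file, g50] -/
theorem isGrandClampedMin_of_isEStarGSC {S : Set E3} (h : IsEStarGSC (μS S)) {C : Set E3} (hC : C ⊆ S) : IsGrandClampedMin S C := by
  intro n xf hxf hrange k R hR hdisj
  have hS : {p : E3 | μS S {p} ≠ 0} = S := Set.ext fun p => mem_iff_μS_singleton_ne_zero S p
  have key := h.2 n xf hxf (by rw [hS, hrange]; exact hC) k R hR (by rw [hS, hrange]; exact hdisj)
  rw [hS, hrange] at key; unfold clampedEnergy eStar; linarith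

/-- the pair sums of an e⋆-GSC configuration against the whole of `S` are summable (the first clause of `IsEStarGSC`, set rewritten). [this file, g50] -/
theorem summable_of_isEStarGSC {S : Set E3} (h : IsEStarGSC (μS S)) (r : E3) : Summable fun y : S => lennardJones (dist r (y : E3)) := by
  have hS : {p : E3 | μS S {p} ≠ 0} = S := Set.ext fun p => mem_iff_μS_singleton_ne_zero S p
  have h1 := h.1 r; rwa [hS] at h1

/-- ★ the GAP FORM of failed grand clamped minimality: SOME enumeration of `C` and SOME finite replacement `R` (any count) avoiding `S ∖ C` with
STRICTLY LOWER grand clamped energy. [this file, g50] -/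
theorem not_isGrandClampedMin_iff {S C : Set E3} : ¬ IsGrandClampedMin S C ↔
    ∃ (n : ℕ) (xf : Fin n → E3), Function.Injective xf ∧ Set.range xf = C ∧ ∃ (k : ℕ) (R : Fin k → E3), Function.Injective R ∧
      Disjoint (Set.range R) (S \ C) ∧ clampedEnergy (S \ C) R - eStar * k < clampedEnergy (S \ C) xf - eStar * n := by
  simp only [IsGrandClampedMin, not_forall, not_le, exists_prop]

/-- the single-site-Nash pair sum over `{q | μS S {q} ≠ 0, q ≠ p}` is the pair sum over the subtype of `S ∖ {p}` (set dictionary). [this file, g50] -/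
theorem tsum_nash_eq (S : Set E3) (p z : E3) :
    ∑' q : {q : E3 // μS S {q} ≠ 0 ∧ q ≠ p}, lennardJones (dist z (q : E3)) = ∑' q : ↥(S \ {p}), lennardJones (dist z (q : E3)) := by
  have hiff : ∀ q : E3, μS S {q} ≠ 0 ∧ q ≠ p ↔ q ∈ S \ {p} := fun q => by
    rw [Set.mem_sdiff, mem_singleton_iff]; exact and_congr_left' (mem_iff_μS_singleton_ne_zero S q)
  simpa only [Equiv.subtypeEquivRight_apply_coe] using
    Equiv.tsum_eq (Equiv.subtypeEquivRight hiff) fun q : ↥(S \ {p}) => lennardJones (dist z (q : E3))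

/-- ★ **DICTIONARY (PROVED): single-site Nash ⟸ clamped minimality of every one-atom region.** [this file, g50] -/
theorem isNash_of_isClampedMin_singleton {S : Set E3} (h : ∀ p ∈ S, IsClampedMin S {p}) : IsNash (μS S) := by
  intro p hp y hy
  have hpS : p ∈ S := (mem_iff_μS_singleton_ne_zero S p).1 hp
  have hyS : y ∉ S \ {p} := fun hy' =>
    hy y ((mem_iff_μS_singleton_ne_zero S y).2 hy'.1) (fun h' => hy'.2 (mem_singleton_iff.2 h')) rfl
  rw [tsum_nash_eq S p p, tsum_nash_eq S p y]
  have hmin := h p hpS 1 (fun _ => p) (Function.injective_of_subsingleton _) Set.range_const (fun _ => y)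
    (Function.injective_of_subsingleton _) (by rw [Set.range_const, Set.disjoint_singleton_left]; exact hyS)
  simpa [clampedEnergy, interactionEnergy_of_subsingleton] using hmin

/-- ★ **DICTIONARY (PROVED): single-site Nash ⇒ clamped minimality of every one-atom region** (an injective enumeration of `{p}` has one term). [this file, g50] -/
theorem isClampedMin_singleton_of_isNash {S : Set E3} (h : IsNash (μS S)) {p : E3} (hpS : p ∈ S) : IsClampedMin S {p} := by
  intro n xf hxf hrange R hR hdisj
  obtain ⟨i₀, hi₀⟩ : p ∈ Set.range xf := by rw [hrange]; exact mem_singleton p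
  have hsub : Subsingleton (Fin n) := ⟨fun i j => hxf (by
    have hi : xf i ∈ ({p} : Set E3) := hrange ▸ mem_range_self i
    have hj : xf j ∈ ({p} : Set E3) := hrange ▸ mem_range_self j
    rw [mem_singleton_iff.1 hi, mem_singleton_iff.1 hj])⟩
  have hn : n = 1 := le_antisymm (Fin.subsingleton_iff_le_one.1 hsub) (Fin.pos i₀)
  subst hn
  have h0 : xf 0 = p := (congrArg xf (Subsingleton.elim 0 i₀)).trans hi₀
  have hy : ∀ q : E3, μS S {q} ≠ 0 → q ≠ p → R 0 ≠ q := fun q hq hqp hRq =>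
    Set.disjoint_left.1 hdisj (mem_range_self (0 : Fin 1))
      ⟨hRq ▸ (mem_iff_μS_singleton_ne_zero S q).1 hq, fun h' => hqp (hRq ▸ mem_singleton_iff.1 h')⟩
  have hN := h p ((mem_iff_μS_singleton_ne_zero S p).2 hpS) (R 0) hy
  rw [tsum_nash_eq S p p, tsum_nash_eq S p (R 0)] at hN
  simpa [clampedEnergy, interactionEnergy_of_subsingleton, h0] using hN

/-- ★ **DICTIONARY (PROVED): SINGLE-SITE NASH ⟺ CLAMPED MINIMALITY OF EVERY ONE-ATOM REGION** — N's binder is the one-atom, equal-count case of the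
door hypothesis of [CG]. [this file, g50] -/
theorem isNash_iff_isClampedMin_singleton (S : Set E3) : IsNash (μS S) ↔ ∀ p ∈ S, IsClampedMin S {p} :=
  ⟨fun h _ hp => isClampedMin_singleton_of_isNash h hp, isNash_of_isClampedMin_singleton⟩

/-! ### YH.2  The `ρ`-core of a container, the door [CG] `ClampedCorePG`, its `M = 1` gap form [CG₁] `CoreGapPG`, and the reductions -/

/-- ★ **`coreOf S K ρ`** — the `ρ`-CORE of the container `K` in `S`: the sites of `S` within `ρ` of some site of `K` (`= S ∩ ⋃_{k ∈ K} closedBall k ρ`);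
with `r₀ ≤ ρ < ℓ` core and moat `moatIn S K r₀ ℓ` cover the `ℓ`-neighbourhood of `K` (record: overlap `8 < d ≤ 12`, where (K3) reads its data). [this file, g50] -/
def coreOf (S K : Set E3) (ρ : ℝ) : Set E3 := {p | p ∈ S ∧ ∃ k ∈ K, dist p k ≤ ρ}

/-- the core lies in `S`. [this file, g50] -/
theorem coreOf_subset (S K : Set E3) (ρ : ℝ) : coreOf S K ρ ⊆ S := fun _ hp => hp.1

/-- the core grows with the clamp radius. [this file, g50] -/
theorem coreOf_mono (S K : Set E3) {ρ ρ' : ℝ} (h : ρ ≤ ρ') : coreOf S K ρ ⊆ coreOf S K ρ' :=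
  fun _ hp => ⟨hp.1, hp.2.imp fun _ ⟨hk, hd⟩ => ⟨hk, hd.trans h⟩⟩

/-- ★ the core of a FINITE container in a SEPARATED configuration is FINITE (a separated set meets every closed ball in a finite set). [this file, g50] -/
theorem coreOf_finite {δ : ℝ} (hδ : 0 < δ) {S : Set E3} (hS : IsSep δ S) {K : Set E3} (hK : K.Finite) (ρ : ℝ) : (coreOf S K ρ).Finite :=
  (hK.biUnion fun k _ => Literature.Probability.Process.LocalConfig.finite_inter_of_separated hδ hS (isCompact_closedBall k ρ)).subset
    fun p hp => by
      obtain ⟨hpS, k, hk, hd⟩ := hp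
      exact mem_biUnion hk ⟨mem_closedBall.2 hd, hpS⟩

/-- ★★★ **[CG] «ClampedCorePG ϑ ϑe ωe p r₀ ℓ M ρ aHi Λ θ s» — A GRAND-CLAMPED-MINIMAL CORE IN A DRESSED FRAME IS TAME** (the special door [I_D] in
LOCAL CLAMPED form).  For every θ-good `aHi`-door set `S` (`IsDoorSetP`: rooted, separated, clean, single-site Nash, charted — NO grand-canonical
hypothesis on the whole of `S`) with summable pair sums, every equilibrium `s`-chart `(L, w)` at scale `a`, and every finite container `K ⊆ S` of
`≤ M` sites whose moat `moatIn S K r₀ ℓ` lies under the `(ϑe, ωe, p)`-envelope of `K` relative to `LayeredHom L w`: IF the `ρ`-core `coreOf S K ρ`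
is a grand clamped minimiser of `S` (`IsGrandClampedMin`, the `IsEStarGSC` clause at that ONE region), THEN every site of `K` is `ϑ`-tame.
`[CG](ρ) ⇒ [I_D]` for every `ρ, M` (PROVED); `[CG](M = 1, ρ) ⟺ [CG₁](ρ)` (PROVED); priced case `M = 1`, record `ρ = clampRadius = 12`.
What a proof must do (g48 §1.6, row 826 (a)): (K1) REGISTRATION — clean + charted + dressed moat ⇒ the core sites correspond bijectively to the
fitted chart sites, `|u| ≤ U₀` (kinematic; ATTACKABLE·M with the tree's tear-free transport; its count half is the foreshadowed [CF]); (K2) NO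
ELASTIC BISTABILITY — uniqueness of the clamped minimiser in the registered clean class below `1 %` boundary strain: (K2a) `Hess E(u) ≥ c·Φ` on the
clean box (finite per-bond interval certificate), (K2b) `E(u) − E(ū) ≥ c·(ϑ − m(ū))²/(2·0.0866) > 0` for hot `u` ([HG], CERT·ATTACKABLE);
count-anomalous clean fillings are killed EITHER kinematically ([CF]) OR by the count-changing competitor and `ΔΩ⋆ ≥ 0.64 ≫ 0.011` (the grand
form keeps both tools); (K3) SLAVING `m(ū) < ϑ` for the filling slaved to the moat data (discrete interior estimate; calibration of record, row 826
(A)(ii): `C_ell(12) ≤ 2.5`, `m_s ≤ 0.0063 ≪ 1/20`) plus the far-exterior `r⁻⁶` tail of the untruncated field (inside the inequality; `≲ 10⁻⁶`).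
For `M > 1` the clamped region is a union of `≤ M` balls and (K2) is asked of the multi-core cluster (unpriced).
MECHANISM-NAMED · LOCAL · FINITE · PRICED·HARMONIC·CALIBRATED at `M = 1` (gap `≥ 0.0110` tree units, `× 0.84` anharmonic `⇒ ≥ 0.0092 ≈ 0.11 ε`,
margin `× 8`) · ATTACKABLE·L (computer-assisted) · INSTRUMENTABLE («F0d″-S») · CENSUS-CONSISTENT ((F0d′) `0/168` clean hot fillings) · UNDECIDED.
Why it might fail: (K2) — a second clean, charted, single-site-Nash clamped minimiser of an LJ ball of radius `ρ` under `≤ 1 %` dressed boundary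
data, hot at a centre site (elastic bistability near the soft tension corner `r ≈ 17/16`); none known, none found by the (F0d′) multistart,
no theorem excludes it («F0d″-S» is its kill test); for `M > 1`, interacting cores within `2ρ`.
Sources: E–Ming, Arch. Ration. Mech. Anal. 183 (2007) 241 and Ortner–Theil, Arch. Ration. Mech. Anal. 207 (2013) 1025 (stability of the Cauchy–Born
filling); Braun–Schmidt, arXiv 1604.00197 (atomistic boundary-value problem); Ehrlacher–Ortner–Shapeev, arXiv 1306.5334 and Braun–Hudson–Ortner,
arXiv 2108.04765 (decay of defect equilibria, slaving); Knops–Payne, Uniqueness Theorems in Linear Elasticity (1971) p. 5; this tree: `IsEStarGSC`,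
`IsNash` (part RigidityDoor), `DressedCorePG` (part UG), `UniformTameStability` (part TP); census `F0ZOO24.md` (j346198, j346199); g48 «CoreGapOne»,
g49 «SlavedFill»; critic rows 805, 826. [this file, g50] -/
def ClampedCorePG (ϑ ϑe ωe : ℝ) (p : ℕ) (r₀ ℓ : ℝ) (M : ℕ) (ρ aHi Λ θ s : ℝ) : Prop :=
  ∀ δ : ℝ, 0 < δ → ∀ a : ℝ, 0 < a →
    ∀ S : Set E3, IsDoorSetP aHi δ S → (∀ r : E3, Summable fun y : S => lennardJones (dist r (y : E3))) →
      (∀ q ∈ S, IsTwoShellAffineGood θ S q) →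
        ∀ (L : E3 ≃L[ℝ] E3) (w : ℤ → E3), IsEquilChart a s Λ L w →
          ∀ K : Set E3, K ⊆ S → K.Finite → K.ncard ≤ M →
            (∀ y ∈ moatIn S K r₀ ℓ, IsUnderEnvelope ϑe ωe p S (LayeredHom (L : E3 →L[ℝ] E3) w) K y) →
              IsGrandClampedMin S (coreOf S K ρ) → IsTameOn ϑ S (LayeredHom (L : E3 →L[ℝ] E3) w) K

/-- ★★★ **[CG](ρ) ⇒ [I_D] (PROVED, every `ρ`, every `M`)** — on an e⋆-GSC door set the `ρ`-core of every container is grand-clamped-minimal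
(`isGrandClampedMin_of_isEStarGSC`) and the pair sums are summable, so the clamped door gives the dressed door. [this file, g50] -/
theorem dressedCorePG_of_clampedCorePG {ϑ ϑe ωe : ℝ} {p : ℕ} {r₀ ℓ : ℝ} {M : ℕ} {ρ aHi Λ θ s : ℝ}
    (h : ClampedCorePG ϑ ϑe ωe p r₀ ℓ M ρ aHi Λ θ s) : DressedCorePG ϑ ϑe ωe p r₀ ℓ M aHi Λ θ s :=
  fun δ hδ a ha S hS hgood L w hLw K hKS hKf hKM hu =>
    h δ hδ a ha S hS.isDoorSetP (summable_of_isEStarGSC hS.gsc) hgood L w hLw K hKS hKf hKM hu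
      (isGrandClampedMin_of_isEStarGSC hS.gsc (coreOf_subset S K ρ))

/-- **[CG] ∧ [T_b] ⇒ [T] (PROVED)** — the clamped door and the bare residual give the hot-star exclusion [T] of part UC. [this file, g50] -/
theorem tameWindowPG_of_clampedCore_of_bare {ϑ ϑe ωe : ℝ} {p : ℕ} {r₀ ℓ : ℝ} {M : ℕ} {ρ aHi Λ θ s : ℝ}
    (hI : ClampedCorePG ϑ ϑe ωe p r₀ ℓ M ρ aHi Λ θ s) (hB : BareTameWindowPG ϑ ϑe ωe p r₀ ℓ M aHi Λ θ s) : TameWindowPG ϑ aHi Λ θ s :=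
  tameWindowPG_of_dressedCore_of_bare (dressedCorePG_of_clampedCorePG hI) hB

/-- TRADE-OFF: [CG] is monotone in `ϑ`, STRONGER with `ϑe, ωe, r₀, M`, WEAKER with `p` and `ℓ` (as [I_D], `ρ` fixed; the `ρ`-dial is
`ClampedCorePG.of_le`, §YH.3). [this file, g50] -/
theorem ClampedCorePG.mono {ϑ ϑ' ϑe ϑe' ωe ωe' r₀ r₀' ℓ ℓ' : ℝ} {p p' : ℕ} {M M' : ℕ} {ρ aHi Λ θ s : ℝ} (he : 0 ≤ ϑe') (hw : 0 ≤ ωe')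
    (h8 : 8 ≤ r₀') (hϑ : ϑ ≤ ϑ') (hϑe : ϑe' ≤ ϑe) (hωe : ωe' ≤ ωe) (hp : p ≤ p') (hr : r₀' ≤ r₀) (hℓ : ℓ ≤ ℓ') (hM : M' ≤ M)
    (h : ClampedCorePG ϑ ϑe ωe p r₀ ℓ M ρ aHi Λ θ s) : ClampedCorePG ϑ' ϑe' ωe' p' r₀' ℓ' M' ρ aHi Λ θ s := by
  intro δ hδ a ha S hS hsum hgood L w hLw K hKS hKf hKM hu hmin
  refine (h δ hδ a ha S hS hsum hgood L w hLw K hKS hKf (hKM.trans hM) (fun y hy => ?_) hmin).mono hϑ subset_rfl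
  obtain ⟨k, hk, hc⟩ := hu y (moatIn_anti S K ℓ' hr (moatIn_mono S K r₀ hℓ hy))
  have hd : 8 ≤ dist y k := (h8.trans hr).trans ((mem_moatIn.1 hy).2.2 k hk).le
  exact ⟨k, hk, hc.mono ((envelope_anti_exp he hd hp).trans (envelope_mono_amp hϑe dist_nonneg p))
    ((envelope_anti_exp hw hd hp).trans (envelope_mono_amp hωe dist_nonneg p))⟩

/-- DEGENERATE END `M = 0` (vacuity guard): [CG] holds trivially. [this file, g50] -/
theorem clampedCorePG_zero (ϑ ϑe ωe : ℝ) (p : ℕ) (r₀ ℓ ρ aHi Λ θ s : ℝ) : ClampedCorePG ϑ ϑe ωe p r₀ ℓ 0 ρ aHi Λ θ s := by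
  intro δ _ a _ S _ _ _ L w _ K _ hKf hK0 _ _ x hx; have h := (Set.ncard_pos hKf).2 ⟨x, hx⟩; omega

/-- ★★★ **[CG₁] «CoreGapPG ϑ ϑe ωe p r₀ ℓ ρ aHi Λ θ s» — A ϑ-HOT REGISTERED CORE ADMITS A FINITE REPLACEMENT STRICTLY LOWERING THE GRAND ENERGY**
(critic row 826 (a), the offered sufficient condition under [I_D](M = 1), in GAP form).  For every θ-good `aHi`-door set `S` (`IsDoorSetP`) with
summable pair sums, every equilibrium chart `(L, w)`, and every site `x ∈ S` whose moat `moatIn S {x} r₀ ℓ` is registered under the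
`(ϑe, ωe, p)`-envelope of `{x}` ((K1)): if the star at `x` is `ϑ`-HOT, then for SOME enumeration `xf` of the `ρ`-core `coreOf S {x} ρ` there is an
injective replacement `R` of SOME count `k`, avoiding the frozen exterior, with `clampedEnergy − e⋆·k` STRICTLY BELOW that of `xf` — the negation of
the `IsEStarGSC` clause at that region (θ-goodness of the interior atoms is inside `∀ q ∈ S`; the exterior tail is inside `clampedEnergy`).
Tags (row 826 (c)): LOCAL · FINITE · PRICED · ATTACKABLE·L · INSTRUMENTABLE («F0d″-S») · UNDECIDED; `⟺ [CG](M = 1, ρ)`, `⇒ [I_D](M = 1)` (PROVED).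
[this file, g50] -/
def CoreGapPG (ϑ ϑe ωe : ℝ) (p : ℕ) (r₀ ℓ ρ aHi Λ θ s : ℝ) : Prop :=
  ∀ δ : ℝ, 0 < δ → ∀ a : ℝ, 0 < a →
    ∀ S : Set E3, IsDoorSetP aHi δ S → (∀ r : E3, Summable fun y : S => lennardJones (dist r (y : E3))) →
      (∀ q ∈ S, IsTwoShellAffineGood θ S q) →
        ∀ (L : E3 ≃L[ℝ] E3) (w : ℤ → E3), IsEquilChart a s Λ L w →
          ∀ x ∈ S, (∀ y ∈ moatIn S {x} r₀ ℓ, IsUnderEnvelope ϑe ωe p S (LayeredHom (L : E3 →L[ℝ] E3) w) {x} y) →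
            ¬ IsTameStar ϑ S (LayeredHom (L : E3 →L[ℝ] E3) w) x →
              ∃ (n : ℕ) (xf : Fin n → E3), Function.Injective xf ∧ Set.range xf = coreOf S {x} ρ ∧
                ∃ (k : ℕ) (R : Fin k → E3), Function.Injective R ∧ Disjoint (Set.range R) (S \ coreOf S {x} ρ) ∧
                  clampedEnergy (S \ coreOf S {x} ρ) R - eStar * k < clampedEnergy (S \ coreOf S {x} ρ) xf - eStar * n

/-- ★★ **[CG₁](ρ) ⇒ [CG](M = 1, ρ) (PROVED)** — a container of `≤ 1` sites is empty or a singleton; contrapose the gap at the singleton. [this file, g50] -/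
theorem clampedCorePG_one_of_coreGapPG {ϑ ϑe ωe : ℝ} {p : ℕ} {r₀ ℓ ρ aHi Λ θ s : ℝ} (h : CoreGapPG ϑ ϑe ωe p r₀ ℓ ρ aHi Λ θ s) :
    ClampedCorePG ϑ ϑe ωe p r₀ ℓ 1 ρ aHi Λ θ s := by
  intro δ hδ a ha S hS hsum hgood L w hLw K hKS hKf hKM hu hmin x hx
  obtain rfl : K = {x} := Set.eq_singleton_iff_unique_mem.2 ⟨hx, fun y hy => (Set.ncard_le_one hKf).1 hKM y hy x hx⟩
  by_contra hot
  exact not_isGrandClampedMin_iff.2 (h δ hδ a ha S hS hsum hgood L w hLw x (hKS rfl) hu hot) hmin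

/-- ★★ **[CG](M = 1, ρ) ⇒ [CG₁](ρ) (PROVED)** — the door at the singleton container, contraposed. [this file, g50] -/
theorem coreGapPG_of_clampedCorePG_one {ϑ ϑe ωe : ℝ} {p : ℕ} {r₀ ℓ ρ aHi Λ θ s : ℝ} (h : ClampedCorePG ϑ ϑe ωe p r₀ ℓ 1 ρ aHi Λ θ s) :
    CoreGapPG ϑ ϑe ωe p r₀ ℓ ρ aHi Λ θ s :=
  fun δ hδ a ha S hS hsum hgood L w hLw x hx hu hot => not_isGrandClampedMin_iff.1 fun hmin =>
    hot (h δ hδ a ha S hS hsum hgood L w hLw {x} (Set.singleton_subset_iff.2 hx) (Set.finite_singleton x) (by rw [Set.ncard_singleton]) hu hmin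
      x rfl)

/-- ★★★ **THE SEAM OF ROW 826 (b) (PROVED, no side condition on `r₀, ρ, ℓ`): [CG₁](ρ) ⇒ [I_D](M = 1)** — unpack `IsDoorSetPG`'s GSC clause at the
finite region `coreOf S {x} ρ = S ∩ closedBall x ρ`. [this file, g50] -/
theorem dressedCorePG_one_of_coreGapPG {ϑ ϑe ωe : ℝ} {p : ℕ} {r₀ ℓ ρ aHi Λ θ s : ℝ} (h : CoreGapPG ϑ ϑe ωe p r₀ ℓ ρ aHi Λ θ s) :
    DressedCorePG ϑ ϑe ωe p r₀ ℓ 1 aHi Λ θ s :=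
  dressedCorePG_of_clampedCorePG (clampedCorePG_one_of_coreGapPG h)

/-! ### YH.3  The clamp-radius dial (PROVED): grand clamped minimality passes to finite sub-regions, so [CG] is WEAKER as `ρ` grows -/

/-- the range of a juxtaposed family is the union of the ranges. [this file, g50] -/
theorem range_append {n m : ℕ} (f : Fin n → E3) (d : Fin m → E3) : Set.range (Fin.append f d) = Set.range f ∪ Set.range d := by
  ext a; constructor
  · rintro ⟨i, rfl⟩
    refine Fin.addCases (fun j => ?_) (fun j => ?_) i
    · exact Or.inl ⟨j, (Fin.append_left f d j).symm⟩
    · exact Or.inr ⟨j, (Fin.append_right f d j).symm⟩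
  · rintro (⟨j, rfl⟩ | ⟨j, rfl⟩)
    · exact ⟨Fin.castAdd m j, Fin.append_left f d j⟩
    · exact ⟨Fin.natAdd n j, Fin.append_right f d j⟩

/-- a field summable over `X` is summable over every `Y ⊆ X`. [this file, g50] -/
theorem summable_subset {g : E3 → ℝ} {X Y : Set E3} (h : Summable (g ∘ (↑) : X → ℝ)) (hYX : Y ⊆ X) : Summable (g ∘ (↑) : Y → ℝ) :=
  (h.comp_injective (Set.inclusion_injective hYX)).congr fun _ => rfl

/-- the field summed over the range of an injective finite family is a finite sum. [this file, g50] -/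
theorem tsum_range_eq_sum {m : ℕ} {d : Fin m → E3} (hd : Function.Injective d) (g : E3 → ℝ) :
    ∑' y : ↥(Set.range d), g y = ∑ j, g (d j) :=
  calc ∑' y : ↥(Set.range d), g y = ∑' j : Fin m, g ((Equiv.ofInjective d hd j : ↥(Set.range d)) : E3) :=
        ((Equiv.ofInjective d hd).tsum_eq fun y : ↥(Set.range d) => g (y : E3)).symm
    _ = ∑ j, g (d j) := by simp only [tsum_fintype, Equiv.ofInjective_apply]

/-- splitting a frozen field at a finite family: `Σ'_{X' ∪ range d} = Σ'_{X'} + Σ_j` (disjoint, summable). [this file, g50] -/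
theorem tsum_union_range_eq {X' : Set E3} {m : ℕ} {d : Fin m → E3} (hd : Function.Injective d) (hdisj : Disjoint X' (Set.range d))
    (g : E3 → ℝ) (hs : Summable fun y : X' => g y) : ∑' y : ↥(X' ∪ Set.range d), g y = ∑' y : X', g y + ∑ j, g (d j) := by
  rw [Summable.tsum_union_disjoint hdisj hs ((Set.finite_range d).summable g), tsum_range_eq_sum hd]

/-- ★ CLAMPED ENERGY OF A JUXTAPOSITION: adding a finite family `d` to the cluster adds its cross terms and a cluster-independent constant. [this file, g50] -/
theorem clampedEnergy_append (X : Set E3) {n m : ℕ} (f : Fin n → E3) (d : Fin m → E3) :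
    clampedEnergy X (Fin.append f d) = clampedEnergy X f + ∑ i, ∑ j, lennardJones (dist (f i) (d j)) +
      (interactionEnergy lennardJones d + ∑ j, ∑' y : X, lennardJones (dist (d j) (y : E3))) := by
  unfold clampedEnergy
  rw [interactionEnergy_append lennardJones Literature.MathematicalPhysics.StatisticalMechanics.lennardJones_zero, Fin.sum_univ_add]
  simp only [Fin.append_left, Fin.append_right]
  ring

/-- ★ CLAMPED ENERGY AGAINST A SPLIT FIELD: freezing a finite family `d` besides `X'` adds exactly the cross terms. [this file, g50] -/
theorem clampedEnergy_union_range {X' : Set E3} {n m : ℕ} {d : Fin m → E3} (hd : Function.Injective d) (hdisj : Disjoint X' (Set.range d))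
    (hs : ∀ r : E3, Summable fun y : X' => lennardJones (dist r (y : E3))) (f : Fin n → E3) :
    clampedEnergy (X' ∪ Set.range d) f = clampedEnergy X' f + ∑ i, ∑ j, lennardJones (dist (f i) (d j)) := by
  have key : ∀ i, ∑' y : ↥(X' ∪ Set.range d), lennardJones (dist (f i) (y : E3)) =
      ∑' y : X', lennardJones (dist (f i) (y : E3)) + ∑ j, lennardJones (dist (f i) (d j)) :=
    fun i => tsum_union_range_eq hd hdisj (fun y => lennardJones (dist (f i) y)) (hs (f i))
  unfold clampedEnergy
  rw [Finset.sum_congr rfl fun i _ => key i, Finset.sum_add_distrib]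
  ring

/-- ★★ **GRAND CLAMPED MINIMALITY PASSES TO SUB-REGIONS (PROVED)**: if the finite region `C' ⊆ S` is grand-clamped-minimal and the pair sums over `S`
are summable, every `C ⊆ C'` is — juxtapose the atoms of `C' ∖ C` to cluster and competitor alike (counts `n + m` vs `k + m`); the extra terms are
the cross terms (moved from the frozen field into the interaction energy), a common constant and `e⋆·m` on both sides. [this file, g50] -/
theorem IsGrandClampedMin.anti {S C C' : Set E3} (hsum : ∀ r : E3, Summable fun y : S => lennardJones (dist r (y : E3))) (hC'S : C' ⊆ S)
    (hfin : C'.Finite) (h : IsGrandClampedMin S C') (hCC' : C ⊆ C') : IsGrandClampedMin S C := by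
  intro n xf hxf hrange k R hR hdisj
  obtain ⟨m, d, hD⟩ := (hfin.subset fun _ hx => hx.1 : (C' \ C).Finite).fin_embedding
  have hdC : ∀ j, d j ∈ C' \ C := fun j => hD ▸ Set.mem_range_self j
  have hxC : ∀ i, xf i ∈ C := fun i => hrange ▸ Set.mem_range_self i
  have hXeq : S \ C = S \ C' ∪ Set.range d := by rw [hD]; exact (Set.sdiff_union_sdiff_cancel hC'S hCC').symm
  have hdisjX : Disjoint (S \ C') (Set.range d) := by rw [hD]; exact Set.disjoint_sdiff_left.mono_right fun _ hx => hx.1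
  have hsum' : ∀ r : E3, Summable fun y : ↥(S \ C') => lennardJones (dist r (y : E3)) :=
    fun r => summable_subset (g := fun y => lennardJones (dist r y)) (hsum r) fun _ hx => hx.1
  have hxf' : Function.Injective (Fin.append xf d) :=
    Fin.append_injective_iff.2 ⟨hxf, d.injective, fun i j hij => (hdC j).2 (hij ▸ hxC i)⟩
  have hrange' : Set.range (Fin.append xf d) = C' := by rw [range_append, hrange, hD]; exact Set.union_sdiff_cancel hCC'
  have hR' : Function.Injective (Fin.append R d) :=
    Fin.append_injective_iff.2 ⟨hR, d.injective, fun i j hij =>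
      Set.disjoint_left.1 hdisj (Set.mem_range_self i) (hij ▸ (⟨hC'S (hdC j).1, (hdC j).2⟩ : d j ∈ S \ C))⟩
  have hdisj' : Disjoint (Set.range (Fin.append R d)) (S \ C') := by
    rw [range_append, Set.disjoint_union_left]
    exact ⟨hdisj.mono_right (Set.sdiff_subset_sdiff_right hCC'), Set.disjoint_left.2 fun x ⟨j, hj⟩ hx => hx.2 (hj ▸ (hdC j).1)⟩
  have key := h (n + m) (Fin.append xf d) hxf' hrange' (k + m) (Fin.append R d) hR' hdisj'
  rw [clampedEnergy_append, clampedEnergy_append] at key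
  simp only [Nat.cast_add, mul_add] at key
  rw [hXeq, clampedEnergy_union_range d.injective hdisjX hsum' xf, clampedEnergy_union_range d.injective hdisjX hsum' R]
  linarith

/-- ★★ **THE CLAMP-RADIUS DIAL (PROVED): `[CG](ρ) ⇒ [CG](ρ')` for `ρ ≤ ρ'`** — a larger clamped region is MORE hypothesis (its grand minimality
gives the smaller core's, `IsGrandClampedMin.anti` with `coreOf_finite`), so the door weakens as `ρ` grows; every member still implies [I_D].
[this file, g50] -/
theorem ClampedCorePG.of_le {ϑ ϑe ωe : ℝ} {p : ℕ} {r₀ ℓ : ℝ} {M : ℕ} {ρ ρ' aHi Λ θ s : ℝ} (hρ : ρ ≤ ρ')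
    (h : ClampedCorePG ϑ ϑe ωe p r₀ ℓ M ρ aHi Λ θ s) : ClampedCorePG ϑ ϑe ωe p r₀ ℓ M ρ' aHi Λ θ s :=
  fun δ hδ a ha S hS hsum hgood L w hLw K hKS hKf hKM hu hmin =>
    h δ hδ a ha S hS hsum hgood L w hLw K hKS hKf hKM hu
      (hmin.anti hsum (coreOf_subset S K ρ') (coreOf_finite hδ hS.2.1 hKf ρ') (coreOf_mono S K hρ))

/-! ### YH.4  The line down to (M) through the clamped door, and the record literals -/

/-- the CLAMP RADIUS of record: `12` (g49 §1, row 826 (A)(i)) — the clamped region is the core `d ≤ 12`; the collar `12 < d < 16` of the dressed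
moat `(8, 16)` carries the boundary data, more than the calibration's force range `3.3 a₀` from either end; `ρ = 8` is the fallback. [this file, g50] -/
def clampRadius : ℝ := 12

/-- the clamp radius of record lies between the record moat radii `r₀ = 8` and `ℓ = collarRadius = 16`. [this file, g50] -/
theorem clampRadius_mem : (8 : ℝ) ≤ clampRadius ∧ clampRadius < collarRadius := by norm_num [clampRadius, collarRadius]

/-- ★★★ **COROLLARY (PROVED): the clamped-core line down to (M)** — with the Gehring leaf (part UB): `[CG] ∧ [T_b] ∧ [KS] ∧ [W] ∧ [CC°_W] ∧ leaf ⇒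
StrainNonConcentrationPG` (`aHi ≤ 8/7`, every `ρ`). [this file, g50] -/
theorem strainNonConcentrationPG_of_clampedCore_line {ϑ ϑe ωe : ℝ} {p : ℕ} {r₀ ℓ : ℝ} {M : ℕ} {ρ aHi Λ θ s : ℝ} (haHi : aHi ≤ 8 / 7)
    (hG : ZatorskaGoldstein2005_localGehringLemmaCounting) (hI : ClampedCorePG ϑ ϑe ωe p r₀ ℓ M ρ aHi Λ θ s)
    (hB : BareTameWindowPG ϑ ϑe ωe p r₀ ℓ M aHi Λ θ s) (hKS : KornSobolevPoincareP aHi θ) (hW : CoherentWindowPG ϑ aHi Λ θ s)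
    (hC : CoherentGscCaccioppoliPG ϑ aHi Λ θ s) : StrainNonConcentrationPG aHi Λ θ s :=
  strainNonConcentrationPG_of_dressedCore_line haHi hG (dressedCorePG_of_clampedCorePG hI) hB hKS hW hC

/-- ★ Record example at `(aHi; Λ, θ, s; ϑ; ϑe, ωe, p, r₀, ℓ, M; ρ) = (1; 2, 1/16, 1/50; tameRadius; dressLevel, dressLevel, dressExponent, 8,
collarRadius, clusterSize; clampRadius)`: the clamped door feeds [I_D] of part UG, and with g46's residual [T_esc] (hence [T_b]) the line to [C];
its `M = 1` gap form [CG₁] at `ρ = clampRadius` feeds the priced instance [I_D](M = 1). -/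
example (hI : ClampedCorePG tameRadius dressLevel dressLevel dressExponent 8 collarRadius clusterSize clampRadius 1 2 (1 / 16) (1 / 50))
    (hG : CoreGapPG tameRadius dressLevel dressLevel dressExponent 8 collarRadius clampRadius 1 2 (1 / 16) (1 / 50))
    (hX : EscapingTameWindowPG tameRadius calmLevel calmLevel collarRadius clusterSize 1 2 (1 / 16) (1 / 50))
    (hKS : KornSobolevPoincareP 1 (1 / 16)) (hW : CoherentWindowPG tameRadius 1 2 (1 / 16) (1 / 50))
    (hC : CoherentGscCaccioppoliPG tameRadius 1 2 (1 / 16) (1 / 50)) :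
    DressedCorePG tameRadius dressLevel dressLevel dressExponent 8 collarRadius clusterSize 1 2 (1 / 16) (1 / 50) ∧
      DressedCorePG tameRadius dressLevel dressLevel dressExponent 8 collarRadius 1 1 2 (1 / 16) (1 / 50) ∧ RigidCaccioppoliPG 1 2 (1 / 16) (1 / 50) :=
  have hB := bareTameWindowPG_of_escapingTameWindowPG dressLevel_nonneg dressLevel_nonneg le_rfl calmLevel_le_envelope_record
    calmLevel_le_envelope_record hX
  ⟨dressedCorePG_of_clampedCorePG hI, dressedCorePG_one_of_coreGapPG hG,
    rigidCaccioppoliPG_of_coherent_line (tameWindowPG_of_clampedCore_of_bare hI hB) hKS hW hC⟩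

end Summit.AtomisticToContinuum.Crystallization.Theorems.ChartedZeroExcessLayeredLatticeLiouville

end
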